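import Mathlib

/-!
# Lift-blindness of Hall-type rows — the finite HALL-LIFT theorem («strengthen» lens g6, MEMO-09 §2, 2026-08-29)

Crux of record: `…Theses.EightfoldBlochSeeds.BlochSeedDiscOne` (item stmt-HodgeConjecture-18881).  NOTHING here proves HC,
HC_AV, HC_CM, H2 or 18881.  This is a finite combinatorial theorem (Hall's condition for a lifted bipartite graph), the kernel
form of colour-1 g2's (T1e) LIFTING LEMMA (memo `T1e-LIFTING-LEMMA-colour1-g2.md` 6b50bd63, pen ×2 idea-crit-6 g13 bus l.8018),
on the letter–copy–twist model ≠ sheaves.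

SETTING.  `X` sources (copies of P-cells, or A-cells / N-cells of a monad), `Y` targets, `B` a finite additive group of bit
patterns (`(ZMod 2)^F` for a τ-lift on the factor set `F`).  `G : X → Finset Y` is the plain live graph and satisfies HALL.
The lifted graph `Γ : X × B → Finset (Y × B)` is only assumed
* `Invariant Γ`  — translation invariance under the global XOR group: `(y,c) ∈ Γ (x,b) → (y,c+t) ∈ Γ (x,b+t)`;
* `Covering G Γ` — hypothesis (K) of the pen proof: every target pattern of a live plain block is reached from SOME source
                    pattern: `y ∈ G x → ∀ c, ∃ b, (y,c) ∈ Γ (x,b)` («one class per block» after any legitimate kill).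
CONCLUSION `hall_lift`: `Γ` satisfies HALL: `∀ U, |U| ≤ |Γ(U)|` — for EVERY `U ⊆ X × B`, rectangular or not.

PROOF (as in the pen, with the lattice of minimisers in place of the lattice of min cuts): the deficiency
`defi U = |Γ(U)| − |U|` is submodular (`defi_submod`), so its minimisers are closed under `∩`; translates of a minimiser are
minimisers (`Invariant`); hence the meet of all translates of one minimiser is a translation-INVARIANT minimiser `U⋆`
(`W`-induction below); an invariant set is a full cylinder over `A₀ = fst(U⋆)` and by `Covering` its neighbourhood contains
`Γ_G(A₀) × B`, so `defi U⋆ ≥ |B|·(|Γ_G(A₀)| − |A₀|) ≥ 0` by HALL for `G` (`card_le_nbr_of_invariant`); therefore every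
deficiency is `≥ defi U⋆ ≥ 0`.  Multiplicities reduce to this statement by replacing a copy-class of mass `m` by `m` elements of
`X` (resp. `Y`) with identical neighbourhoods (the standard blow-up; the hypotheses are preserved).

THEOREMS (all sorry-free, `import Mathlib` only):
* `hall_lift`            — the statement above (cardinality form);
* `defi_lift_ge` + `defi_prod_univ` — the SCALING LAW: if every plain set has deficiency `≥ m` then every lifted set has
  deficiency `≥ |B|·m`, and the full lift `A × B` of a plain set attains exactly `|B| ×` its plain deficiency (needs `Projects`:
  lifted blocks lie over plain blocks) ⇒ min lifted deficiency = `|B| ×` min plain deficiency; an inherited kill (key on an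
  UNLIFTED factor) therefore fails with deficit exactly `× |B|` — the converse half of T1e and the `2 ×` digits of every table;
* `hall_lift_weighted`   — masses on sources ∕ capacities on targets copied to the lift (the cell's weighted rows KI ∕ KQ);
* `defiW_ge_of_diagonal` + `defiW_prod_univ` — bc5-plan g14's R8 LIFT SANDWICH `k_min(D) ≤ k_min(D♯) ≤ |B|·k_min(D)` (weighted
  surplus over NON-EMPTY sets; lower half for DIAGONAL = kill-free lifts and uses HALL(D), exactly as in the pen l.8055; upper half for
  any lift with `Projects` + `Covering`) ⇒ TIGHT (`k_min = 0`) is lift-invariant, SILENT (`k_min ≥ 8`) lift-monotone;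
* `TauLift.graph_invariant`, `TauLift.graph_covering`, `TauLift.hall`, `TauLift.hall_weighted` — the CONCRETE killed τ-lift of
  LEMMA τ (bit forced equal on non-moving factors; both classes live on moving = lifted null `k = 1` factors; a kill removing, per
  (block, moving factor), AT MOST ONE of the two classes — `one_class`, automatic for a point ∕ curve key since the two curves are
  disjoint translates) satisfies `Invariant` and `Covering`, hence passes HALL ∕ weighted HALL whenever the plain design does.

USE (MEMO-09 §2).  With `B = (ZMod 2)^F`, `F` ⊇ the key-bearing factors, and `Γ` = the (B1♯)∕(B2)-pairs∕STRATA∕HALL♯-killed full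
τ-lift of a plain-Hall design on the LINE (every W₁-kill key on the LINE sits on a null `k = 1` step, so every key is a
`one_class` kill), the theorems say the killed lift passes every Hall-type row with the plain margins `× |B|`: every
FLOW-category S⁺ «(A1)-clean ∧ Hall-type rows ⇒ μ = 0» is refuted in the rank-free room by (ac808a66)♯ ∕ (08162ddb)♯
(machine instance: `eng/liftcheck.py`, tables in MEMO-09 §2.3).  The JOINT row KJ (sources A ⊔ C, shared N-capacity) IS the weighted HALL row of the SUM graph
`X := A ⊕ C → N` (`G (inl a) = Γ_i a`, `G (inr c) = Γ_q⁻¹ c`), so `hall_lift_weighted` ∕ `TauLift.hall_weighted` apply to it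
verbatim with `X × B = (A ⊕ C) × B` (machine-checked in the tables as well).
-/

set_option linter.dupNamespace false
set_option autoImplicit false

namespace Summit.HodgeConjecture.HodgeConjecture.Cruxes.BlochSeedDiscOne.LiftBlind

open Finset

variable {X Y B : Type*}

/-- Neighbourhood of a set of lifted sources. -/
def nbr [DecidableEq Y] [DecidableEq B] (Γ : X × B → Finset (Y × B)) (U : Finset (X × B)) : Finset (Y × B) := U.biUnion Γ

/-- Integer deficiency `|Γ(U)| − |U|`. -/
def defi [DecidableEq Y] [DecidableEq B] (Γ : X × B → Finset (Y × B)) (U : Finset (X × B)) : ℤ :=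
  ((nbr Γ U).card : ℤ) - (U.card : ℤ)

lemma nbr_union [DecidableEq X] [DecidableEq Y] [DecidableEq B] (Γ : X × B → Finset (Y × B)) (U V : Finset (X × B)) :
    nbr Γ (U ∪ V) = nbr Γ U ∪ nbr Γ V := by
  ext q
  simp only [nbr, mem_biUnion, mem_union]
  constructor
  · rintro ⟨p, hp | hp, hq⟩
    · exact Or.inl ⟨p, hp, hq⟩
    · exact Or.inr ⟨p, hp, hq⟩
  · rintro (⟨p, hp, hq⟩ | ⟨p, hp, hq⟩)
    · exact ⟨p, Or.inl hp, hq⟩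
    · exact ⟨p, Or.inr hp, hq⟩

lemma nbr_inter_subset [DecidableEq X] [DecidableEq Y] [DecidableEq B] (Γ : X × B → Finset (Y × B)) (U V : Finset (X × B)) :
    nbr Γ (U ∩ V) ⊆ nbr Γ U ∩ nbr Γ V := by
  intro q hq
  simp only [nbr, mem_biUnion, mem_inter] at hq ⊢
  obtain ⟨p, ⟨hpU, hpV⟩, hq⟩ := hq
  exact ⟨⟨p, hpU, hq⟩, ⟨p, hpV, hq⟩⟩

lemma nbr_mono [DecidableEq Y] [DecidableEq B] (Γ : X × B → Finset (Y × B)) {U V : Finset (X × B)} (h : U ⊆ V) :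
    nbr Γ U ⊆ nbr Γ V := by
  intro q hq
  simp only [nbr, mem_biUnion] at hq ⊢
  obtain ⟨p, hp, hq⟩ := hq
  exact ⟨p, h hp, hq⟩

/-- Submodularity of the deficiency. -/
lemma defi_submod [DecidableEq X] [DecidableEq Y] [DecidableEq B] (Γ : X × B → Finset (Y × B)) (U V : Finset (X × B)) :
    defi Γ (U ∩ V) + defi Γ (U ∪ V) ≤ defi Γ U + defi Γ V := by
  have h1 : (((U ∪ V).card : ℕ) : ℤ) + ((U ∩ V).card : ℤ) = (U.card : ℤ) + (V.card : ℤ) := by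
    exact_mod_cast Finset.card_union_add_card_inter U V
  have h2 : (((nbr Γ U ∪ nbr Γ V).card : ℕ) : ℤ) + ((nbr Γ U ∩ nbr Γ V).card : ℤ)
      = ((nbr Γ U).card : ℤ) + ((nbr Γ V).card : ℤ) := by
    exact_mod_cast Finset.card_union_add_card_inter (nbr Γ U) (nbr Γ V)
  have h3 : (((nbr Γ (U ∩ V)).card : ℕ) : ℤ) ≤ ((nbr Γ U ∩ nbr Γ V).card : ℤ) := by
    exact_mod_cast Finset.card_le_card (nbr_inter_subset Γ U V)
  have h4 : nbr Γ (U ∪ V) = nbr Γ U ∪ nbr Γ V := nbr_union Γ U V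
  unfold defi
  rw [h4]
  linarith

/-- Projection property: every lifted block lies over a plain block. -/
def Projects (G : X → Finset Y) (Γ : X × B → Finset (Y × B)) : Prop :=
  ∀ (x : X) (b : B) (y : Y) (c : B), (y, c) ∈ Γ (x, b) → y ∈ G x

/-- Covering property (hypothesis (K) of T1e): over every plain block and every target copy-class SOME source copy-class is
live — «at most one of the two curve classes killed per block». -/
def Covering (G : X → Finset Y) (Γ : X × B → Finset (Y × B)) : Prop :=
  ∀ (x : X) (y : Y), y ∈ G x → ∀ c : B, ∃ b : B, (y, c) ∈ Γ (x, b)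

lemma nbr_prod_univ [DecidableEq Y] [DecidableEq B] [Fintype B] {G : X → Finset Y} {Γ : X × B → Finset (Y × B)}
    (hproj : Projects G Γ) (hcov : Covering G Γ) (A : Finset X) :
    nbr Γ (A ×ˢ (Finset.univ : Finset B)) = (A.biUnion G) ×ˢ (Finset.univ : Finset B) := by
  ext q
  obtain ⟨y, c⟩ := q
  rw [nbr, mem_biUnion, mem_product, mem_biUnion]
  constructor
  · rintro ⟨⟨x, b⟩, hp, h⟩
    rw [mem_product] at hp
    exact ⟨⟨x, hp.1, hproj x b y c h⟩, mem_univ _⟩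
  · rintro ⟨⟨x, hx, hy⟩, -⟩
    obtain ⟨b, hb⟩ := hcov x y hy c
    refine ⟨(x, b), ?_, hb⟩
    rw [mem_product]
    exact ⟨hx, mem_univ _⟩

/-- **Scaling law, attained part.**  The full lift `A × B` of a plain set has deficiency exactly `|B| ×` the plain deficiency
(so an inherited kill — a key on an UNLIFTED factor, i.e. the lift of a Hall-failing plain graph — fails with deficit `× |B|`:
the `2 × 73 455`, `2 × 432`, `2 × 135`, `2 × 1 283` digits of the machine tables). -/
theorem defi_prod_univ [DecidableEq Y] [DecidableEq B] [Fintype B] {G : X → Finset Y} {Γ : X × B → Finset (Y × B)}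
    (hproj : Projects G Γ) (hcov : Covering G Γ) (A : Finset X) :
    defi Γ (A ×ˢ (Finset.univ : Finset B)) = (Fintype.card B : ℤ) * (((A.biUnion G).card : ℤ) - A.card) := by
  unfold defi
  rw [nbr_prod_univ hproj hcov A, card_product, card_product, card_univ]
  push_cast
  ring

section Group

variable [AddCommGroup B]

/-- Translation of lifted sources by `t`. -/
def shiftX (t : B) : X × B ↪ X × B :=
  ⟨fun p => (p.1, p.2 + t), by
    intro p q h
    simp only [Prod.mk.injEq, add_left_inj] at h
    exact Prod.ext h.1 h.2⟩

/-- Translation of lifted targets by `t`. -/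
def shiftY (t : B) : Y × B ↪ Y × B :=
  ⟨fun p => (p.1, p.2 + t), by
    intro p q h
    simp only [Prod.mk.injEq, add_left_inj] at h
    exact Prod.ext h.1 h.2⟩

@[simp] lemma shiftX_apply (t : B) (p : X × B) : shiftX (X := X) t p = (p.1, p.2 + t) := rfl
@[simp] lemma shiftY_apply (t : B) (p : Y × B) : shiftY (Y := Y) t p = (p.1, p.2 + t) := rfl

/-- Translation invariance of the lifted graph (the global XOR group acts by automorphisms). -/
def Invariant (Γ : X × B → Finset (Y × B)) : Prop :=
  ∀ (x : X) (b : B) (y : Y) (c : B) (t : B), (y, c) ∈ Γ (x, b) → (y, c + t) ∈ Γ (x, b + t)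


lemma nbr_map [DecidableEq Y] [DecidableEq B] {Γ : X × B → Finset (Y × B)} (hΓ : Invariant Γ) (t : B) (U : Finset (X × B)) :
    nbr Γ (U.map (shiftX t)) = (nbr Γ U).map (shiftY t) := by
  ext q
  obtain ⟨y, c⟩ := q
  simp only [nbr, mem_biUnion, mem_map, shiftX_apply, shiftY_apply, Prod.exists, Prod.mk.injEq]
  constructor
  · rintro ⟨x', b', ⟨x, b, hxb, hx, hb⟩, hmem⟩
    subst hx; subst hb
    refine ⟨y, c - t, ⟨x, b, hxb, ?_⟩, rfl, by abel⟩
    have h := hΓ x (b + t) y c (-t) hmem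
    have e1 : c + -t = c - t := by abel
    have e2 : b + t + -t = b := by abel
    rw [e1, e2] at h
    exact h
  · rintro ⟨y', c', ⟨x, b, hxb, hmem⟩, hy, hc⟩
    subst hy; subst hc
    exact ⟨x, b + t, ⟨x, b, hxb, rfl, rfl⟩, hΓ x b y' c' t hmem⟩

lemma defi_map [DecidableEq Y] [DecidableEq B] {Γ : X × B → Finset (Y × B)} (hΓ : Invariant Γ) (t : B) (U : Finset (X × B)) :
    defi Γ (U.map (shiftX t)) = defi Γ U := by
  unfold defi
  rw [nbr_map hΓ t U, card_map, card_map]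

variable [Fintype B]

/-- An invariant set of lifted sources expands: `|U| ≤ |Γ(U)|` (HALL for `G` + Covering). -/
lemma card_le_nbr_of_invariant [DecidableEq X] [DecidableEq Y] [DecidableEq B] (G : X → Finset Y) (hG : ∀ A : Finset X, A.card ≤ (A.biUnion G).card)
    (Γ : X × B → Finset (Y × B)) (hcov : Covering G Γ)
    (U : Finset (X × B)) (hU : ∀ p ∈ U, ∀ s : B, (p.1, p.2 + s) ∈ U) :
    U.card ≤ (nbr Γ U).card := by
  classical
  set A₀ : Finset X := U.image Prod.fst with hA₀
  have hsub : U ⊆ A₀ ×ˢ (Finset.univ : Finset B) := by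
    intro p hp
    rw [mem_product]
    exact ⟨mem_image_of_mem Prod.fst hp, mem_univ _⟩
  have h1 : U.card ≤ A₀.card * Fintype.card B := by
    calc U.card ≤ (A₀ ×ˢ (Finset.univ : Finset B)).card := card_le_card hsub
      _ = A₀.card * (Finset.univ : Finset B).card := card_product _ _
      _ = A₀.card * Fintype.card B := by rw [card_univ]
  have h2 : (A₀.biUnion G) ×ˢ (Finset.univ : Finset B) ⊆ nbr Γ U := by
    intro q hq
    obtain ⟨y, c⟩ := q
    rw [mem_product] at hq
    obtain ⟨hy, -⟩ := hq
    rw [mem_biUnion] at hy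
    obtain ⟨x, hx, hyx⟩ := hy
    rw [hA₀, mem_image] at hx
    obtain ⟨p, hpU, hpx⟩ := hx
    obtain ⟨b, hb⟩ := hcov x y hyx c
    have hxb : (x, b) ∈ U := by
      have h := hU p hpU (b - p.2)
      have e : p.2 + (b - p.2) = b := by abel
      rw [e, hpx] at h
      exact h
    simp only [nbr, mem_biUnion]
    exact ⟨(x, b), hxb, hb⟩
  have h3 : (A₀.biUnion G).card * Fintype.card B ≤ (nbr Γ U).card := by
    have h := card_le_card h2
    rwa [card_product, card_univ] at h
  calc U.card ≤ A₀.card * Fintype.card B := h1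
    _ ≤ (A₀.biUnion G).card * Fintype.card B := Nat.mul_le_mul_right _ (hG A₀)
    _ ≤ (nbr Γ U).card := h3

variable [Fintype X]

/-- **HALL-LIFT THEOREM (lift-blindness).**  If the plain graph `G` satisfies HALL and the lifted graph `Γ` on `X × B` is
translation-invariant and covering, then `Γ` satisfies HALL for every set of lifted sources. -/
theorem hall_lift [DecidableEq X] [DecidableEq Y] [DecidableEq B] (G : X → Finset Y) (hG : ∀ A : Finset X, A.card ≤ (A.biUnion G).card)
    (Γ : X × B → Finset (Y × B)) (hinv : Invariant Γ) (hcov : Covering G Γ) :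
    ∀ U : Finset (X × B), U.card ≤ (U.biUnion Γ).card := by
  classical
  -- a global minimiser of the deficiency
  obtain ⟨U₀, -, hmin⟩ :=
    Finset.exists_min_image (Finset.univ : Finset (Finset (X × B))) (defi Γ) Finset.univ_nonempty
  have hmin' : ∀ U : Finset (X × B), defi Γ U₀ ≤ defi Γ U := fun U => hmin U (mem_univ U)
  -- minimisers are closed under intersection (submodularity)
  have hcap : ∀ U V : Finset (X × B), defi Γ U = defi Γ U₀ → defi Γ V = defi Γ U₀ →
      defi Γ (U ∩ V) = defi Γ U₀ := by
    intro U V hU hV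
    have hs := defi_submod Γ U V
    have h1 := hmin' (U ∩ V)
    have h2 := hmin' (U ∪ V)
    linarith
  -- translates of the minimiser are minimisers
  have hshift : ∀ t : B, defi Γ (U₀.map (shiftX t)) = defi Γ U₀ := fun t => defi_map hinv t U₀
  -- the meet of the translates, built by induction on a finite set of group elements
  let W : Finset B → Finset (X × B) := fun s => U₀.filter (fun p => ∀ t ∈ s, (p.1, p.2 - t) ∈ U₀)
  have hWstep : ∀ (t : B) (s : Finset B), W (insert t s) = W s ∩ U₀.map (shiftX t) := by
    intro t s
    ext ⟨x0, b0⟩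
    simp only [W, mem_filter, mem_inter, mem_map, shiftX_apply, mem_insert, forall_eq_or_imp, Prod.exists,
      Prod.mk.injEq]
    constructor
    · rintro ⟨hp, hpt, hps⟩
      exact ⟨⟨hp, hps⟩, x0, b0 - t, hpt, rfl, by abel⟩
    · rintro ⟨⟨hp, hps⟩, x, b, hxb, hx, hb⟩
      refine ⟨hp, ?_, hps⟩
      have e : b0 - t = b := by rw [← hb]; abel
      rw [← hx, e]
      exact hxb
  have hW : ∀ s : Finset B, defi Γ (W s) = defi Γ U₀ := by
    intro s
    induction s using Finset.induction_on with
    | empty =>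
      have e : W ∅ = U₀ := by
        ext p
        simp only [W, mem_filter, Finset.notMem_empty, IsEmpty.forall_iff, implies_true, and_true]
      rw [e]
    | insert t s hts ih =>
      rw [hWstep t s]
      exact hcap _ _ ih (hshift t)
  -- the invariant minimiser
  have hstar_mem : ∀ p : X × B, p ∈ W Finset.univ ↔ ∀ t : B, (p.1, p.2 - t) ∈ U₀ := by
    intro p
    simp only [W, mem_filter, mem_univ, forall_const, and_iff_right_iff_imp]
    intro h
    have h0 := h 0
    simp only [sub_zero, Prod.mk.eta] at h0
    exact h0
  have hstar_inv : ∀ p ∈ W Finset.univ, ∀ s : B, (p.1, p.2 + s) ∈ W Finset.univ := by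
    intro p hp s
    rw [hstar_mem] at hp ⊢
    intro t
    have h := hp (t - s)
    have e : p.2 + s - t = p.2 - (t - s) := by abel
    simp only
    rw [e]
    exact h
  have hstar_nonneg : 0 ≤ defi Γ (W Finset.univ) := by
    have h := card_le_nbr_of_invariant G hG Γ hcov (W Finset.univ) hstar_inv
    unfold defi
    have h' : (((W Finset.univ).card : ℕ) : ℤ) ≤ ((nbr Γ (W Finset.univ)).card : ℤ) := by exact_mod_cast h
    linarith
  -- conclusion
  intro U
  have hU := hmin' U
  rw [← hW Finset.univ] at hU
  have h : (0 : ℤ) ≤ defi Γ U := le_trans hstar_nonneg hU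
  unfold defi nbr at h
  have : (U.card : ℤ) ≤ ((U.biUnion Γ).card : ℤ) := by linarith
  exact_mod_cast this

omit [Fintype X] in
/-- Generalised expansion: an invariant set of lifted sources has deficiency `≥ |B| ×` (plain deficiency of its projection). -/
lemma defi_invariant_ge [DecidableEq X] [DecidableEq Y] [DecidableEq B] (G : X → Finset Y) (m : ℤ)
    (hG : ∀ A : Finset X, m ≤ ((A.biUnion G).card : ℤ) - A.card)
    (Γ : X × B → Finset (Y × B)) (hcov : Covering G Γ)
    (U : Finset (X × B)) (hU : ∀ p ∈ U, ∀ s : B, (p.1, p.2 + s) ∈ U) :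
    (Fintype.card B : ℤ) * m ≤ defi Γ U := by
  classical
  set A₀ : Finset X := U.image Prod.fst with hA₀
  have hsub : U ⊆ A₀ ×ˢ (Finset.univ : Finset B) := by
    intro p hp
    rw [mem_product]
    exact ⟨mem_image_of_mem Prod.fst hp, mem_univ _⟩
  have h1 : U.card ≤ A₀.card * Fintype.card B := by
    calc U.card ≤ (A₀ ×ˢ (Finset.univ : Finset B)).card := card_le_card hsub
      _ = A₀.card * (Finset.univ : Finset B).card := card_product _ _
      _ = A₀.card * Fintype.card B := by rw [card_univ]
  have h2 : (A₀.biUnion G) ×ˢ (Finset.univ : Finset B) ⊆ nbr Γ U := by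
    intro q hq
    obtain ⟨y, c⟩ := q
    rw [mem_product] at hq
    obtain ⟨hy, -⟩ := hq
    rw [mem_biUnion] at hy
    obtain ⟨x, hx, hyx⟩ := hy
    rw [hA₀, mem_image] at hx
    obtain ⟨p, hpU, hpx⟩ := hx
    obtain ⟨b, hb⟩ := hcov x y hyx c
    have hxb : (x, b) ∈ U := by
      have h := hU p hpU (b - p.2)
      have e : p.2 + (b - p.2) = b := by abel
      rw [e, hpx] at h
      exact h
    simp only [nbr, mem_biUnion]
    exact ⟨(x, b), hxb, hb⟩
  have h3 : (A₀.biUnion G).card * Fintype.card B ≤ (nbr Γ U).card := by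
    have h := card_le_card h2
    rwa [card_product, card_univ] at h
  have h1' : (U.card : ℤ) ≤ (A₀.card : ℤ) * (Fintype.card B : ℤ) := by exact_mod_cast h1
  have h3' : ((A₀.biUnion G).card : ℤ) * (Fintype.card B : ℤ) ≤ ((nbr Γ U).card : ℤ) := by exact_mod_cast h3
  have hk : (0 : ℤ) ≤ (Fintype.card B : ℤ) := by exact_mod_cast Nat.zero_le _
  have hm := mul_le_mul_of_nonneg_left (hG A₀) hk
  unfold defi
  linarith

/-- **Scaling law, inequality part (HALL-LIFT with defect).**  If every plain set has deficiency `≥ m` (`m ≤ 0`; `m = 0` is HALL),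
then every set of lifted sources of a translation-invariant covering lift has deficiency `≥ |B| · m`.  With `defi_prod_univ`
(attained on full lifts `A × B`): the minimum lifted deficiency is EXACTLY `|B| ×` the minimum plain deficiency. -/
theorem defi_lift_ge [DecidableEq X] [DecidableEq Y] [DecidableEq B] (G : X → Finset Y) (m : ℤ)
    (hG : ∀ A : Finset X, m ≤ ((A.biUnion G).card : ℤ) - A.card)
    (Γ : X × B → Finset (Y × B)) (hinv : Invariant Γ) (hcov : Covering G Γ) :
    ∀ U : Finset (X × B), (Fintype.card B : ℤ) * m ≤ ((U.biUnion Γ).card : ℤ) - U.card := by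
  classical
  -- a global minimiser of the deficiency
  obtain ⟨U₀, -, hmin⟩ :=
    Finset.exists_min_image (Finset.univ : Finset (Finset (X × B))) (defi Γ) Finset.univ_nonempty
  have hmin' : ∀ U : Finset (X × B), defi Γ U₀ ≤ defi Γ U := fun U => hmin U (mem_univ U)
  -- minimisers are closed under intersection (submodularity)
  have hcap : ∀ U V : Finset (X × B), defi Γ U = defi Γ U₀ → defi Γ V = defi Γ U₀ →
      defi Γ (U ∩ V) = defi Γ U₀ := by
    intro U V hU hV
    have hs := defi_submod Γ U V
    have h1 := hmin' (U ∩ V)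
    have h2 := hmin' (U ∪ V)
    linarith
  -- translates of the minimiser are minimisers
  have hshift : ∀ t : B, defi Γ (U₀.map (shiftX t)) = defi Γ U₀ := fun t => defi_map hinv t U₀
  -- the meet of the translates, built by induction on a finite set of group elements
  let W : Finset B → Finset (X × B) := fun s => U₀.filter (fun p => ∀ t ∈ s, (p.1, p.2 - t) ∈ U₀)
  have hWstep : ∀ (t : B) (s : Finset B), W (insert t s) = W s ∩ U₀.map (shiftX t) := by
    intro t s
    ext ⟨x0, b0⟩
    simp only [W, mem_filter, mem_inter, mem_map, shiftX_apply, mem_insert, forall_eq_or_imp, Prod.exists,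
      Prod.mk.injEq]
    constructor
    · rintro ⟨hp, hpt, hps⟩
      exact ⟨⟨hp, hps⟩, x0, b0 - t, hpt, rfl, by abel⟩
    · rintro ⟨⟨hp, hps⟩, x, b, hxb, hx, hb⟩
      refine ⟨hp, ?_, hps⟩
      have e : b0 - t = b := by rw [← hb]; abel
      rw [← hx, e]
      exact hxb
  have hW : ∀ s : Finset B, defi Γ (W s) = defi Γ U₀ := by
    intro s
    induction s using Finset.induction_on with
    | empty =>
      have e : W ∅ = U₀ := by
        ext p
        simp only [W, mem_filter, Finset.notMem_empty, IsEmpty.forall_iff, implies_true, and_true]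
      rw [e]
    | insert t s hts ih =>
      rw [hWstep t s]
      exact hcap _ _ ih (hshift t)
  -- the invariant minimiser
  have hstar_mem : ∀ p : X × B, p ∈ W Finset.univ ↔ ∀ t : B, (p.1, p.2 - t) ∈ U₀ := by
    intro p
    simp only [W, mem_filter, mem_univ, forall_const, and_iff_right_iff_imp]
    intro h
    have h0 := h 0
    simp only [sub_zero, Prod.mk.eta] at h0
    exact h0
  have hstar_inv : ∀ p ∈ W Finset.univ, ∀ s : B, (p.1, p.2 + s) ∈ W Finset.univ := by
    intro p hp s
    rw [hstar_mem] at hp ⊢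
    intro t
    have h := hp (t - s)
    have e : p.2 + s - t = p.2 - (t - s) := by abel
    simp only
    rw [e]
    exact h
  have hstar_ge : (Fintype.card B : ℤ) * m ≤ defi Γ (W Finset.univ) :=
    defi_invariant_ge G m hG Γ hcov (W Finset.univ) hstar_inv
  -- conclusion
  intro U
  have hU := hmin' U
  rw [← hW Finset.univ] at hU
  have h : (Fintype.card B : ℤ) * m ≤ defi Γ U := le_trans hstar_ge hU
  unfold defi nbr at h
  exact h
end Group

/-! ## Weighted form (masses on sources, capacities on targets), as used by the cell's rows -/

section Weighted

/-- Weighted deficiency `cap(Γ(U)) − m(U)` with lifted masses `m p.1` and capacities `cap q.1`. -/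
def defiW [DecidableEq Y] [DecidableEq B] (m : X → ℕ) (cap : Y → ℕ) (Γ : X × B → Finset (Y × B))
    (U : Finset (X × B)) : ℤ :=
  ((∑ q ∈ nbr Γ U, cap q.1 : ℕ) : ℤ) - ((∑ p ∈ U, m p.1 : ℕ) : ℤ)

lemma defiW_submod [DecidableEq X] [DecidableEq Y] [DecidableEq B] (m : X → ℕ) (cap : Y → ℕ)
    (Γ : X × B → Finset (Y × B)) (U V : Finset (X × B)) :
    defiW m cap Γ (U ∩ V) + defiW m cap Γ (U ∪ V) ≤ defiW m cap Γ U + defiW m cap Γ V := by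
  have h1 : (((∑ p ∈ U ∪ V, m p.1 : ℕ)) : ℤ) + ((∑ p ∈ U ∩ V, m p.1 : ℕ) : ℤ)
      = ((∑ p ∈ U, m p.1 : ℕ) : ℤ) + ((∑ p ∈ V, m p.1 : ℕ) : ℤ) := by
    exact_mod_cast Finset.sum_union_inter
  have h2 : (((∑ q ∈ nbr Γ U ∪ nbr Γ V, cap q.1 : ℕ)) : ℤ) + ((∑ q ∈ nbr Γ U ∩ nbr Γ V, cap q.1 : ℕ) : ℤ)
      = ((∑ q ∈ nbr Γ U, cap q.1 : ℕ) : ℤ) + ((∑ q ∈ nbr Γ V, cap q.1 : ℕ) : ℤ) := by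
    exact_mod_cast Finset.sum_union_inter
  have h3 : (((∑ q ∈ nbr Γ (U ∩ V), cap q.1 : ℕ)) : ℤ) ≤ ((∑ q ∈ nbr Γ U ∩ nbr Γ V, cap q.1 : ℕ) : ℤ) := by
    exact_mod_cast Finset.sum_le_sum_of_subset_of_nonneg (nbr_inter_subset Γ U V) (fun _ _ _ => Nat.zero_le _)
  have h4 : nbr Γ (U ∪ V) = nbr Γ U ∪ nbr Γ V := nbr_union Γ U V
  unfold defiW
  rw [h4]
  linarith

variable [AddCommGroup B]

lemma defiW_map [DecidableEq Y] [DecidableEq B] (m : X → ℕ) (cap : Y → ℕ) {Γ : X × B → Finset (Y × B)}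
    (hΓ : Invariant Γ) (t : B) (U : Finset (X × B)) :
    defiW m cap Γ (U.map (shiftX t)) = defiW m cap Γ U := by
  unfold defiW
  rw [nbr_map hΓ t U, Finset.sum_map, Finset.sum_map]
  simp only [shiftX_apply, shiftY_apply]

variable [Fintype B]

/-- Weighted expansion of an invariant set of lifted sources. -/
lemma mass_le_cap_of_invariant [DecidableEq X] [DecidableEq Y] [DecidableEq B] (m : X → ℕ) (cap : Y → ℕ)
    (G : X → Finset Y) (hG : ∀ A : Finset X, ∑ x ∈ A, m x ≤ ∑ y ∈ A.biUnion G, cap y)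
    (Γ : X × B → Finset (Y × B)) (hcov : Covering G Γ)
    (U : Finset (X × B)) (hU : ∀ p ∈ U, ∀ s : B, (p.1, p.2 + s) ∈ U) :
    ∑ p ∈ U, m p.1 ≤ ∑ q ∈ nbr Γ U, cap q.1 := by
  classical
  set A₀ : Finset X := U.image Prod.fst with hA₀
  have hsub : U ⊆ A₀ ×ˢ (Finset.univ : Finset B) := by
    intro p hp
    rw [mem_product]
    exact ⟨mem_image_of_mem Prod.fst hp, mem_univ _⟩
  have h1 : ∑ p ∈ U, m p.1 ≤ (∑ x ∈ A₀, m x) * Fintype.card B := by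
    calc ∑ p ∈ U, m p.1 ≤ ∑ p ∈ A₀ ×ˢ (Finset.univ : Finset B), m p.1 :=
          Finset.sum_le_sum_of_subset_of_nonneg hsub (fun _ _ _ => Nat.zero_le _)
      _ = ∑ x ∈ A₀, ∑ _b ∈ (Finset.univ : Finset B), m x :=
            Finset.sum_product A₀ (Finset.univ : Finset B) (fun p : X × B => m p.1)
      _ = (∑ x ∈ A₀, m x) * Fintype.card B := by
          rw [Finset.sum_mul]
          refine Finset.sum_congr rfl ?_
          intro x _
          rw [Finset.sum_const, card_univ, smul_eq_mul, mul_comm]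
  have h2 : (A₀.biUnion G) ×ˢ (Finset.univ : Finset B) ⊆ nbr Γ U := by
    intro q hq
    obtain ⟨y, c⟩ := q
    rw [mem_product] at hq
    obtain ⟨hy, -⟩ := hq
    rw [mem_biUnion] at hy
    obtain ⟨x, hx, hyx⟩ := hy
    rw [hA₀, mem_image] at hx
    obtain ⟨p, hpU, hpx⟩ := hx
    obtain ⟨b, hb⟩ := hcov x y hyx c
    have hxb : (x, b) ∈ U := by
      have h := hU p hpU (b - p.2)
      have e : p.2 + (b - p.2) = b := by abel
      rw [e, hpx] at h
      exact h
    simp only [nbr, mem_biUnion]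
    exact ⟨(x, b), hxb, hb⟩
  have h3 : (∑ y ∈ A₀.biUnion G, cap y) * Fintype.card B ≤ ∑ q ∈ nbr Γ U, cap q.1 := by
    calc (∑ y ∈ A₀.biUnion G, cap y) * Fintype.card B
          = ∑ y ∈ A₀.biUnion G, ∑ _c ∈ (Finset.univ : Finset B), cap y := by
            rw [Finset.sum_mul]
            refine Finset.sum_congr rfl ?_
            intro y _
            rw [Finset.sum_const, card_univ, smul_eq_mul, mul_comm]
      _ = ∑ q ∈ (A₀.biUnion G) ×ˢ (Finset.univ : Finset B), cap q.1 :=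
            (Finset.sum_product (A₀.biUnion G) (Finset.univ : Finset B) (fun q : Y × B => cap q.1)).symm
      _ ≤ ∑ q ∈ nbr Γ U, cap q.1 := Finset.sum_le_sum_of_subset_of_nonneg h2 (fun _ _ _ => Nat.zero_le _)
  calc ∑ p ∈ U, m p.1 ≤ (∑ x ∈ A₀, m x) * Fintype.card B := h1
    _ ≤ (∑ y ∈ A₀.biUnion G, cap y) * Fintype.card B := Nat.mul_le_mul_right _ (hG A₀)
    _ ≤ ∑ q ∈ nbr Γ U, cap q.1 := h3

variable [Fintype X]

/-- **Weighted HALL-LIFT THEOREM.**  Masses `m` on plain sources and capacities `cap` on plain targets, copied to the lift;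
if the plain graph passes weighted HALL and the lift is translation-invariant and covering, the lift passes weighted HALL. -/
theorem hall_lift_weighted [DecidableEq X] [DecidableEq Y] [DecidableEq B] (m : X → ℕ) (cap : Y → ℕ)
    (G : X → Finset Y) (hG : ∀ A : Finset X, ∑ x ∈ A, m x ≤ ∑ y ∈ A.biUnion G, cap y)
    (Γ : X × B → Finset (Y × B)) (hinv : Invariant Γ) (hcov : Covering G Γ) :
    ∀ U : Finset (X × B), ∑ p ∈ U, m p.1 ≤ ∑ q ∈ U.biUnion Γ, cap q.1 := by
  classical
  obtain ⟨U₀, -, hmin⟩ :=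
    Finset.exists_min_image (Finset.univ : Finset (Finset (X × B))) (defiW m cap Γ) Finset.univ_nonempty
  have hmin' : ∀ U : Finset (X × B), defiW m cap Γ U₀ ≤ defiW m cap Γ U := fun U => hmin U (mem_univ U)
  have hcap : ∀ U V : Finset (X × B), defiW m cap Γ U = defiW m cap Γ U₀ → defiW m cap Γ V = defiW m cap Γ U₀ →
      defiW m cap Γ (U ∩ V) = defiW m cap Γ U₀ := by
    intro U V hU hV
    have hs := defiW_submod m cap Γ U V
    have h1 := hmin' (U ∩ V)
    have h2 := hmin' (U ∪ V)
    linarith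
  have hshift : ∀ t : B, defiW m cap Γ (U₀.map (shiftX t)) = defiW m cap Γ U₀ :=
    fun t => defiW_map m cap hinv t U₀
  let W : Finset B → Finset (X × B) := fun s => U₀.filter (fun p => ∀ t ∈ s, (p.1, p.2 - t) ∈ U₀)
  have hWstep : ∀ (t : B) (s : Finset B), W (insert t s) = W s ∩ U₀.map (shiftX t) := by
    intro t s
    ext ⟨x0, b0⟩
    simp only [W, mem_filter, mem_inter, mem_map, shiftX_apply, mem_insert, forall_eq_or_imp, Prod.exists,
      Prod.mk.injEq]
    constructor
    · rintro ⟨hp, hpt, hps⟩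
      exact ⟨⟨hp, hps⟩, x0, b0 - t, hpt, rfl, by abel⟩
    · rintro ⟨⟨hp, hps⟩, x, b, hxb, hx, hb⟩
      refine ⟨hp, ?_, hps⟩
      have e : b0 - t = b := by rw [← hb]; abel
      rw [← hx, e]
      exact hxb
  have hW : ∀ s : Finset B, defiW m cap Γ (W s) = defiW m cap Γ U₀ := by
    intro s
    induction s using Finset.induction_on with
    | empty =>
      have e : W ∅ = U₀ := by
        ext p
        simp only [W, mem_filter, Finset.notMem_empty, IsEmpty.forall_iff, implies_true, and_true]
      rw [e]
    | insert t s hts ih =>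
      rw [hWstep t s]
      exact hcap _ _ ih (hshift t)
  have hstar_mem : ∀ p : X × B, p ∈ W Finset.univ ↔ ∀ t : B, (p.1, p.2 - t) ∈ U₀ := by
    intro p
    simp only [W, mem_filter, mem_univ, forall_const, and_iff_right_iff_imp]
    intro h
    have h0 := h 0
    simp only [sub_zero, Prod.mk.eta] at h0
    exact h0
  have hstar_inv : ∀ p ∈ W Finset.univ, ∀ s : B, (p.1, p.2 + s) ∈ W Finset.univ := by
    intro p hp s
    rw [hstar_mem] at hp ⊢
    intro t
    have h := hp (t - s)
    have e : p.2 + s - t = p.2 - (t - s) := by abel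
    simp only
    rw [e]
    exact h
  have hstar_nonneg : 0 ≤ defiW m cap Γ (W Finset.univ) := by
    have h := mass_le_cap_of_invariant m cap G hG Γ hcov (W Finset.univ) hstar_inv
    unfold defiW
    have h' : (((∑ p ∈ W Finset.univ, m p.1 : ℕ)) : ℤ) ≤ ((∑ q ∈ nbr Γ (W Finset.univ), cap q.1 : ℕ) : ℤ) := by
      exact_mod_cast h
    linarith
  intro U
  have hU := hmin' U
  rw [← hW Finset.univ] at hU
  have h : (0 : ℤ) ≤ defiW m cap Γ U := le_trans hstar_nonneg hU
  unfold defiW nbr at h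
  have : (((∑ p ∈ U, m p.1 : ℕ)) : ℤ) ≤ ((∑ q ∈ U.biUnion Γ, cap q.1 : ℕ) : ℤ) := by linarith
  exact_mod_cast this

end Weighted

/-! ## The kill-free sandwich (bc5-plan g14's R8 LIFT SANDWICH, lower half): `k_min(D) ≤ k_min(D♯)` -/

section Sandwich

/-- Kill-free (diagonal) lifts: every same-pattern copy of a live plain block is live — bc5-plan g14's canonical τ-lift
WITHOUT kill sets (memo `R8-LIFT-SANDWICH-bc5g14.md` 317a232e, pen ×2 idea-crit-6 g13 bus l.8055). -/
def Diagonal (G : X → Finset Y) (Γ : X × B → Finset (Y × B)) : Prop :=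
  ∀ (x : X) (y : Y), y ∈ G x → ∀ b : B, (y, b) ∈ Γ (x, b)

/-- plain fibre of a lifted set over the pattern `ε` -/
def fib [DecidableEq X] [DecidableEq B] (U : Finset (X × B)) (ε : B) : Finset X :=
  (U.filter (fun p => p.2 = ε)).image Prod.fst

lemma mem_fib [DecidableEq X] [DecidableEq B] (U : Finset (X × B)) (ε : B) (x : X) :
    x ∈ fib U ε ↔ (x, ε) ∈ U := by
  unfold fib
  rw [mem_image]
  constructor
  · rintro ⟨⟨x', b⟩, hp, rfl⟩
    rw [mem_filter] at hp
    obtain ⟨hp, hb⟩ := hp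
    simp only at hb
    subst hb
    exact hp
  · intro h
    exact ⟨(x, ε), by rw [mem_filter]; exact ⟨h, rfl⟩, rfl⟩

/-- mass of a lifted set = sum over patterns of the masses of its plain fibres -/
lemma mass_fiberwise [DecidableEq X] [DecidableEq B] [Fintype B] (m : X → ℕ) (U : Finset (X × B)) :
    ∑ p ∈ U, m p.1 = ∑ ε ∈ (Finset.univ : Finset B), ∑ x ∈ fib U ε, m x := by
  rw [← Finset.sum_fiberwise_of_maps_to (s := U) (t := (Finset.univ : Finset B)) (g := Prod.snd) (fun _ _ => mem_univ _)
    (f := fun p => m p.1)]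
  refine Finset.sum_congr rfl ?_
  intro ε _
  unfold fib
  rw [Finset.sum_image]
  · rintro ⟨x, b⟩ hp ⟨x', b'⟩ hq h
    rw [Finset.mem_coe, mem_filter] at hp hq
    simp only at h hp hq
    rw [h, hp.2, hq.2]

/-- **Sandwich, lower half** (weighted).  For a DIAGONAL lift of a plain graph satisfying weighted HALL, every NON-EMPTY set of
lifted sources has surplus `≥ k` whenever every non-empty plain set has surplus `≥ k`: `k_min(D♯) ≥ k_min(D)`.  (The upper half
`k_min(D♯) ≤ |B|·k_min(D)` is `defi_prod_univ` ∕ its weighted analogue: full lifts `A × B` attain `|B| ×` the plain surplus.) -/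
theorem defiW_ge_of_diagonal [DecidableEq X] [DecidableEq Y] [DecidableEq B] [Fintype B]
    (m : X → ℕ) (cap : Y → ℕ) (G : X → Finset Y) (Γ : X × B → Finset (Y × B)) (hdiag : Diagonal G Γ)
    (hHall : ∀ A : Finset X, ∑ x ∈ A, m x ≤ ∑ y ∈ A.biUnion G, cap y)
    (k : ℤ) (hk : ∀ A : Finset X, A.Nonempty → k ≤ ((∑ y ∈ A.biUnion G, cap y : ℕ) : ℤ) - ((∑ x ∈ A, m x : ℕ) : ℤ))
    (U : Finset (X × B)) (hU : U.Nonempty) :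
    k ≤ ((∑ q ∈ U.biUnion Γ, cap q.1 : ℕ) : ℤ) - ((∑ p ∈ U, m p.1 : ℕ) : ℤ) := by
  classical
  -- the diagonal part of the neighbourhood
  set T : Finset (Y × B) := (Finset.univ : Finset B).biUnion (fun ε => ((fib U ε).biUnion G) ×ˢ ({ε} : Finset B)) with hT
  have hTsub : T ⊆ U.biUnion Γ := by
    intro q hq
    obtain ⟨y, c⟩ := q
    rw [hT, mem_biUnion] at hq
    obtain ⟨ε, -, hq⟩ := hq
    rw [mem_product, mem_singleton] at hq
    obtain ⟨hy, hc⟩ := hq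
    simp only at hc
    subst hc
    rw [mem_biUnion] at hy
    obtain ⟨x, hx, hyx⟩ := hy
    rw [mem_fib] at hx
    rw [mem_biUnion]
    exact ⟨(x, c), hx, hdiag x y hyx c⟩
  -- its capacity, fibrewise
  have hTfib : ∀ ε : B, T.filter (fun q => q.2 = ε) = ((fib U ε).biUnion G) ×ˢ ({ε} : Finset B) := by
    intro ε
    ext ⟨y, c⟩
    rw [mem_filter, hT, mem_biUnion, mem_product, mem_singleton]
    constructor
    · rintro ⟨⟨ε', -, h⟩, hc⟩
      rw [mem_product, mem_singleton] at h
      simp only at hc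
      subst hc
      obtain ⟨hy, hc'⟩ := h
      simp only at hc'
      subst hc'
      exact ⟨hy, rfl⟩
    · rintro ⟨hy, hc⟩
      simp only at hc
      subst hc
      exact ⟨⟨c, mem_univ _, by rw [mem_product, mem_singleton]; exact ⟨hy, rfl⟩⟩, rfl⟩
  have hTcap : ∑ q ∈ T, cap q.1 = ∑ ε ∈ (Finset.univ : Finset B), ∑ y ∈ (fib U ε).biUnion G, cap y := by
    rw [← Finset.sum_fiberwise_of_maps_to (s := T) (t := (Finset.univ : Finset B)) (g := Prod.snd) (fun _ _ => mem_univ _)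
      (f := fun q => cap q.1)]
    refine Finset.sum_congr rfl ?_
    intro ε _
    rw [hTfib ε, Finset.sum_product]
    refine Finset.sum_congr rfl ?_
    intro y _
    rw [Finset.sum_singleton]
  have hcapT : ∑ q ∈ T, cap q.1 ≤ ∑ q ∈ U.biUnion Γ, cap q.1 :=
    Finset.sum_le_sum_of_subset_of_nonneg hTsub (fun _ _ _ => Nat.zero_le _)
  -- fibrewise surplus d ε ≥ 0, and ≥ k on a non-empty fibre
  set d : B → ℤ := fun ε => ((∑ y ∈ (fib U ε).biUnion G, cap y : ℕ) : ℤ) - ((∑ x ∈ fib U ε, m x : ℕ) : ℤ) with hd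
  have hd0 : ∀ ε, 0 ≤ d ε := by
    intro ε
    have h := hHall (fib U ε)
    have h' : ((∑ x ∈ fib U ε, m x : ℕ) : ℤ) ≤ ((∑ y ∈ (fib U ε).biUnion G, cap y : ℕ) : ℤ) := by exact_mod_cast h
    simp only [hd]
    linarith
  obtain ⟨p, hp⟩ := hU
  have hne : (fib U p.2).Nonempty := ⟨p.1, by rw [mem_fib]; exact hp⟩
  have hkp : k ≤ d p.2 := hk _ hne
  have hsum : d p.2 ≤ ∑ ε ∈ (Finset.univ : Finset B), d ε :=
    Finset.single_le_sum (fun ε _ => hd0 ε) (mem_univ p.2)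
  have hsplit : ∑ ε ∈ (Finset.univ : Finset B), d ε
      = ((∑ ε ∈ (Finset.univ : Finset B), ∑ y ∈ (fib U ε).biUnion G, cap y : ℕ) : ℤ)
        - ((∑ ε ∈ (Finset.univ : Finset B), ∑ x ∈ fib U ε, m x : ℕ) : ℤ) := by
    simp only [hd]
    push_cast
    rw [Finset.sum_sub_distrib]
  rw [mass_fiberwise m U]
  have hc : ((∑ ε ∈ (Finset.univ : Finset B), ∑ y ∈ (fib U ε).biUnion G, cap y : ℕ) : ℤ) ≤ ((∑ q ∈ U.biUnion Γ, cap q.1 : ℕ) : ℤ) := by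
    rw [← hTcap]
    exact_mod_cast hcapT
  linarith

/-- **Sandwich, upper half ∕ scaling law attained** (weighted): the full lift `A × B` of a plain set has weighted surplus exactly
`|B| ×` the plain one (for any lift with `Projects` + `Covering`, killed or not). -/
theorem defiW_prod_univ [DecidableEq Y] [DecidableEq B] [Fintype B] (m : X → ℕ) (cap : Y → ℕ)
    {G : X → Finset Y} {Γ : X × B → Finset (Y × B)} (hproj : Projects G Γ) (hcov : Covering G Γ) (A : Finset X) :
    ((∑ q ∈ (A ×ˢ (Finset.univ : Finset B)).biUnion Γ, cap q.1 : ℕ) : ℤ) - ((∑ p ∈ A ×ˢ (Finset.univ : Finset B), m p.1 : ℕ) : ℤ)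
      = (Fintype.card B : ℤ) * (((∑ y ∈ A.biUnion G, cap y : ℕ) : ℤ) - ((∑ x ∈ A, m x : ℕ) : ℤ)) := by
  have h := nbr_prod_univ hproj hcov A
  unfold nbr at h
  rw [h, Finset.sum_product, Finset.sum_product]
  have e1 : ∑ y ∈ A.biUnion G, ∑ _c ∈ (Finset.univ : Finset B), cap y = (∑ y ∈ A.biUnion G, cap y) * Fintype.card B := by
    rw [Finset.sum_mul]
    refine Finset.sum_congr rfl ?_
    intro y _
    rw [Finset.sum_const, card_univ, smul_eq_mul, mul_comm]
  have e2 : ∑ x ∈ A, ∑ _c ∈ (Finset.univ : Finset B), m x = (∑ x ∈ A, m x) * Fintype.card B := by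
    rw [Finset.sum_mul]
    refine Finset.sum_congr rfl ?_
    intro x _
    rw [Finset.sum_const, card_univ, smul_eq_mul, mul_comm]
  rw [e1, e2]
  push_cast
  ring

end Sandwich

/-! ## The τ-lift of record (LEMMA τ live rule + «one class per block» kills) satisfies the two hypotheses -/

section Tau

variable {F : Type*} [Fintype F] [DecidableEq F]

/-- Data of a killed τ-lift on the factor set `F` (LEMMA τ, T1e §1 ∕ monad-1 g4 (V1): liveness depends on `b ⊕ c` only): the
plain live graph `G`; for each plain block the set `moving x y ⊆ F` of factors with `Δ_f ≥ 1`, on which BOTH bit-classes are live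
(null `k = 1` step: `b_f = c_f` = the original kill curve, `b_f ≠ c_f` = its disjoint `P_τ`-translate, W₁-killable one class at a
time; `Δ_f ≥ 2` ∕ ample: bit-blind, never W₁-killed — encode with both kill flags `false`); on the factors with `Δ_f = 0` the bit is
forced equal (`Hom(L, L ⊗ P_τ) = P_τ` has no section).  The kill removes, per (block, moving factor), AT MOST ONE of the two classes
(`one_class` — a point ∕ curve key meets at most one of two disjoint parallel curves; no legitimate row holds both). -/
structure TauLift (X Y F : Type*) where
  G : X → Finset Y
  moving : X → Y → Finset F
  killSame : X → Y → F → Bool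
  killDiff : X → Y → F → Bool
  one_class : ∀ x y f, ¬ (killSame x y f = true ∧ killDiff x y f = true)

/-- Liveness of the lifted block `(x,b) → (y,c)` after the kill. -/
def TauLift.Live (L : TauLift X Y F) (x : X) (b : F → ZMod 2) (y : Y) (c : F → ZMod 2) : Prop :=
  y ∈ L.G x ∧ (∀ f, f ∉ L.moving x y → b f = c f) ∧
    (∀ f ∈ L.moving x y, (b f = c f → L.killSame x y f = false) ∧ (b f ≠ c f → L.killDiff x y f = false))

open scoped Classical in
/-- The killed lifted graph `Γ`. -/
noncomputable def TauLift.graph (L : TauLift X Y F) (p : X × (F → ZMod 2)) : Finset (Y × (F → ZMod 2)) :=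
  ((L.G p.1) ×ˢ (Finset.univ : Finset (F → ZMod 2))).filter (fun q => L.Live p.1 p.2 q.1 q.2)

lemma TauLift.mem_graph (L : TauLift X Y F) (x : X) (b : F → ZMod 2) (y : Y) (c : F → ZMod 2) :
    (y, c) ∈ L.graph (x, b) ↔ L.Live x b y c := by
  classical
  unfold TauLift.graph
  rw [Finset.mem_filter, Finset.mem_product]
  constructor
  · rintro ⟨-, h⟩; exact h
  · intro h; exact ⟨⟨h.1, Finset.mem_univ _⟩, h⟩

omit [Fintype F] [DecidableEq F] in
lemma TauLift.live_shift (L : TauLift X Y F) (x : X) (b : F → ZMod 2) (y : Y) (c : F → ZMod 2) (t : F → ZMod 2) :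
    L.Live x b y c → L.Live x (b + t) y (c + t) := by
  rintro ⟨hy, hfix, hmov⟩
  refine ⟨hy, ?_, ?_⟩
  · intro f hf
    simp only [Pi.add_apply, hfix f hf]
  · intro f hf
    have key : (b + t) f = (c + t) f ↔ b f = c f := by
      simp only [Pi.add_apply, add_left_inj]
    refine ⟨fun h => (hmov f hf).1 (key.mp h), fun h => (hmov f hf).2 (fun h' => h (key.mpr h'))⟩

theorem TauLift.graph_invariant (L : TauLift X Y F) : Invariant L.graph := by
  intro x b y c t h
  rw [TauLift.mem_graph] at h ⊢
  exact L.live_shift x b y c t h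

theorem TauLift.graph_projects (L : TauLift X Y F) : Projects L.G L.graph := by
  intro x b y c h
  rw [TauLift.mem_graph] at h
  exact h.1

theorem TauLift.graph_covering (L : TauLift X Y F) : Covering L.G L.graph := by
  intro x y hy c
  -- source pattern: flip the bit exactly on the moving factors whose `same` class is killed
  let b : F → ZMod 2 := fun f => if f ∈ L.moving x y ∧ L.killSame x y f = true then c f + 1 else c f
  have hb_fix : ∀ f, ¬ (f ∈ L.moving x y ∧ L.killSame x y f = true) → b f = c f := fun f h => if_neg h
  have hb_flip : ∀ f, (f ∈ L.moving x y ∧ L.killSame x y f = true) → b f = c f + 1 := fun f h => if_pos h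
  have hne : ∀ f, c f + 1 ≠ c f := by
    intro f h
    have h2 : (1 : ZMod 2) = 0 := add_left_cancel (h.trans (add_zero (c f)).symm)
    exact (by decide : (1 : ZMod 2) ≠ 0) h2
  refine ⟨b, ?_⟩
  rw [TauLift.mem_graph]
  refine ⟨hy, fun f hf => hb_fix f (fun h => hf h.1), fun f hf => ⟨fun hbc => ?_, fun hbc => ?_⟩⟩
  · cases hs : L.killSame x y f with
    | false => rfl
    | true =>
      exfalso
      have h1 := hb_flip f ⟨hf, hs⟩
      rw [h1] at hbc
      exact hne f hbc
  · cases hd : L.killDiff x y f with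
    | false => rfl
    | true =>
      exfalso
      have hks : ¬ (f ∈ L.moving x y ∧ L.killSame x y f = true) := by
        rintro ⟨-, hs⟩
        exact L.one_class x y f ⟨hs, hd⟩
      exact hbc (hb_fix f hks)

/-- **The killed full τ-lift of a plain-Hall design passes HALL** (cardinality form). -/
theorem TauLift.hall [Fintype X] [DecidableEq X] [DecidableEq Y] (L : TauLift X Y F)
    (hG : ∀ A : Finset X, A.card ≤ (A.biUnion L.G).card) :
    ∀ U : Finset (X × (F → ZMod 2)), U.card ≤ (U.biUnion L.graph).card :=
  hall_lift L.G hG L.graph L.graph_invariant L.graph_covering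

/-- **The killed full τ-lift of a plain-Hall design passes weighted HALL** (masses ∕ capacities copied to the lift). -/
theorem TauLift.hall_weighted [Fintype X] [DecidableEq X] [DecidableEq Y] (L : TauLift X Y F)
    (m : X → ℕ) (cap : Y → ℕ) (hG : ∀ A : Finset X, ∑ x ∈ A, m x ≤ ∑ y ∈ A.biUnion L.G, cap y) :
    ∀ U : Finset (X × (F → ZMod 2)), ∑ p ∈ U, m p.1 ≤ ∑ q ∈ U.biUnion L.graph, cap q.1 :=
  hall_lift_weighted m cap L.G hG L.graph L.graph_invariant L.graph_covering

/-- **Scaling law for the killed τ-lift**: lifted Hall margins ∕ deficits are exactly `2^|F| ×` the plain ones (inequality part;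
the attained part is `defi_prod_univ L.graph_projects L.graph_covering`). -/
theorem TauLift.defi_ge [Fintype X] [DecidableEq X] [DecidableEq Y] (L : TauLift X Y F) (m : ℤ)
    (hG : ∀ A : Finset X, m ≤ ((A.biUnion L.G).card : ℤ) - A.card) :
    ∀ U : Finset (X × (F → ZMod 2)), (Fintype.card (F → ZMod 2) : ℤ) * m ≤ ((U.biUnion L.graph).card : ℤ) - U.card :=
  defi_lift_ge L.G m hG L.graph L.graph_invariant L.graph_covering

end Tau

end Summit.HodgeConjecture.HodgeConjecture.Cruxes.BlochSeedDiscOne.LiftBlind
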